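import Literature.Topology.FourManifolds.ThickenedPlanarHandlebody
import Literature.Topology.FourManifolds.MorseChartChange
import HarnessLib

/-!
# Radial thickenings `Φ(x₀, x₁, x₂² + x₃²)` on `ℝ⁴`: critical points, Hessian, index

Topic `Literature/Topology/FourManifolds`; model-space calculus for the fact seat
`provefact-Literature.Topology.FourManifolds.exists_isBalancedGKTrisection` (Gay–Kirby 2016,
Thm. 4 via §4, Lemma 14).  Everything in this file is **proved**; the three `def`s are plain
coordinate maps on the model space (no named facts).

In a Morse-theoretic construction of Gay–Kirby's trisection the sectors `X₂ ⊇ [0, ε] × H₁₂ ∪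
2`-handles and `X₃` are cut out of `X ∖ X̊₁` by a smooth function `G`, and their handle
decompositions (clause (ii) of `Literature.Topology.FourManifolds.IsGKTrisection`) are read
off the critical points of `G`.  Near a critical point `c` of index `2` of the Morse function
`f` of the handle decomposition — i.e. inside a `2`-handle, in Milnor's coordinates
`(x, y) ∈ ℝ² × ℝ²`, `f = f(c) - |x|² + |y|²` (*Lectures on the h-cobordism theorem* (1965),
Def. 3.1 and the proof of Thm. 3.13) — `G` is taken **rotation-invariant in the co-core
variable `y`**, `G = Φ(x, |y|²)`, with `∂Φ/∂b > 0` (`b = |y|²`): then all critical points of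
`G` in the handle lie on the core disc `{y = 0}`, where they are the critical points of the
planar function `g₀ = Φ(·, 0)`, nondegeneracy transfers, and the Morse index is that of `g₀`
— the co-core directions contribute the positive square `2 (∂Φ/∂b) |dy|²`.  This is the
mechanism by which the `2`-handle swallows the index-`2` point: no critical point of index
`≥ 2` survives in the sector once `g₀` has only minima and saddles (Gay–Kirby's "the
`2`-handles cancel `g - k` of the `S¹ × B³`'s", proof of Lemma 14, in function language).
The tree's `ThickenedPlanarHandlebody.lean` is the case `Φ(u, b) = q(u) + b` in one co-core
variable (`q(x, y) + z²` on `ℝ³`); here the dependence on `b` is arbitrary and `y ∈ ℝ²`.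

Contents (`Φ : ℝ³ → ℝ`, `toModel (x₀, x₁, x₂, x₃) = (x₀, x₁, x₂² + x₃²)`,
`rthicken Φ = Φ ∘ toModel`, `g₀ = Φ ∘ ι` with `ι(u) = (u, 0)` the tree's
`PlanarThickening.lift`):

* `fderiv_fderiv_comp_apply` — the general second-order chain rule
  `D²(F ∘ τ)(v, w) = D²F(Dτ v, Dτ w) + DF(D²τ(v, w))` (the tree's
  `fderiv_fderiv_comp_apply_of_fderiv_eq_zero` is the case `DF = 0`);
* first and second derivatives of `toModel` and of `rthicken Φ`
  (`hasFDerivAt_toModel`, `fderiv_rthicken`, `fderiv_fderiv_rthicken_apply`);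
* `fderiv_rthicken_eq_zero_iff` — for `∂Φ/∂b ≠ 0`: `D(rthicken Φ)(p) = 0` iff `p₂ = p₃ = 0`
  and `Dg₀(π p) = 0`;
* `mhessian_rthicken_apply`, `nondegenerate_mhessian_rthicken_iff`, `morseIndex_rthicken` — on
  the core disc the Hessian is `Hess g₀ ⊕ 2 (∂Φ/∂b) ⟨·, ·⟩_{ℝ²}`, so (for `∂Φ/∂b > 0`)
  nondegeneracy and the index are those of `g₀` (`Literature.Topology.FourManifolds.sigNeg_eq_of_proj`,
  Sylvester);
* `isMCriticalPt_rthicken_iff`, `mem_criticalSetOfIndex_rthicken_iff` — the same in the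
  vocabulary of `Morse.lean` on the model spaces `𝓡 4`, `𝓡 2`.

## References

* D. Gay, R. Kirby, *Trisecting 4-manifolds*, Geom. Topol. 20 (2016) 3097–3132, §4, Lemma 14
  and its proof. [GayKirby2016]
* J. Milnor, *Lectures on the h-cobordism theorem* (1965), Def. 3.1, proof of Thm. 3.13 (the
  handle in Morse coordinates). [MilnorHCobordism1965]
* J. Milnor, *Morse theory* (1963), §2 (index; Sylvester's law). [Milnor1963]
-/

open scoped Manifold ContDiff Topology
open Set Function Filter

noncomputable section

namespace Literature.Topology.FourManifolds

/-- Local notation: `𝔼 n` is the model Euclidean space `EuclideanSpace ℝ (Fin n)`. -/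
local notation "𝔼 " n:arg => EuclideanSpace ℝ (Fin n)

/-! ### The general second-order chain rule -/

section Calculus

variable {E E' : Type*} [NormedAddCommGroup E] [NormedSpace ℝ E] [NormedAddCommGroup E']
  [NormedSpace ℝ E']

/-- **Second-order chain rule.**  If `F` is `C²` at `τ u₀` and `τ` is `C²` at `u₀`, then
`D²(F ∘ τ)(u₀)(v, w) = D²F(τ u₀)(Dτ(u₀) v, Dτ(u₀) w) + DF(τ u₀)(D²τ(u₀)(v, w))`
(Milnor 1963, §2, p. 4, the computation behind the coordinate-independence of the Hessian at
a critical point; the tree's `fderiv_fderiv_comp_apply_of_fderiv_eq_zero` is the case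
`DF(τ u₀) = 0`).  The same statement is proved, with the same proof, as
`ExpHeight.fderiv_fderiv_comp_apply` in `HeightTwoCriticalBall.lean`; it is repeated here (30
lines of calculus) rather than imported because that file sits on top of the Schoenflies /
exp-height line (`ExpHeightBall`, `SchoenfliesBallSide`, `SurgeryRegularDomain`, …), which
the trisection files should not depend on. [cite: Milnor1963, §2] -/
theorem fderiv_fderiv_comp_apply {F : E → ℝ} {τ : E' → E} {u₀ : E'}
    (hF : ContDiffAt ℝ 2 F (τ u₀)) (hτ : ContDiffAt ℝ 2 τ u₀) (v w : E') :
    fderiv ℝ (fderiv ℝ (F ∘ τ)) u₀ v w =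
      fderiv ℝ (fderiv ℝ F) (τ u₀) (fderiv ℝ τ u₀ v) (fderiv ℝ τ u₀ w) +
        fderiv ℝ F (τ u₀) (fderiv ℝ (fderiv ℝ τ) u₀ v w) := by
  have hτd : ∀ᶠ u in 𝓝 u₀, DifferentiableAt ℝ τ u :=
    (hτ.eventually (by simp)).mono fun u hu => hu.differentiableAt (by simp)
  have hFd : ∀ᶠ z in 𝓝 (τ u₀), DifferentiableAt ℝ F z :=
    (hF.eventually (by simp)).mono fun z hz => hz.differentiableAt (by simp)
  have hFd' : ∀ᶠ u in 𝓝 u₀, DifferentiableAt ℝ F (τ u) := hτ.continuousAt.eventually hFd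
  have heq : fderiv ℝ (F ∘ τ) =ᶠ[𝓝 u₀] fun u => (fderiv ℝ F (τ u)).comp (fderiv ℝ τ u) :=
    (hFd'.and hτd).mono fun u hu => fderiv_comp u hu.1 hu.2
  rw [heq.fderiv_eq]
  have hc : HasFDerivAt (fun u => fderiv ℝ F (τ u))
      ((fderiv ℝ (fderiv ℝ F) (τ u₀)).comp (fderiv ℝ τ u₀)) u₀ := by
    have h1 : DifferentiableAt ℝ (fderiv ℝ F) (τ u₀) :=
      (hF.fderiv_right (m := 1) (by norm_num)).differentiableAt (by simp)
    have h2 : DifferentiableAt ℝ τ u₀ := hτ.differentiableAt (by simp)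
    exact h1.hasFDerivAt.comp u₀ h2.hasFDerivAt
  have hd : HasFDerivAt (fun u => fderiv ℝ τ u) (fderiv ℝ (fderiv ℝ τ) u₀) u₀ :=
    ((hτ.fderiv_right (m := 1) (by norm_num)).differentiableAt (by simp)).hasFDerivAt
  rw [(hc.clm_comp hd).fderiv]
  simp only [add_apply, ContinuousLinearMap.comp_apply, ContinuousLinearMap.flip_apply,
    ContinuousLinearMap.compL_apply]
  ring

/-- **Second derivative of the composition with a continuous linear map** (the case
`D²τ = 0` of the second-order chain rule): `D²(F ∘ L)(u)(v, w) = D²F(L u)(L v, L w)`.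
[cite: Milnor1963, §2] -/
theorem fderiv_fderiv_comp_clm_apply {F : E → ℝ} (L : E' →L[ℝ] E) {u₀ : E'}
    (hF : ContDiffAt ℝ 2 F (L u₀)) (v w : E') :
    fderiv ℝ (fderiv ℝ (F ∘ L)) u₀ v w = fderiv ℝ (fderiv ℝ F) (L u₀) (L v) (L w) := by
  rw [fderiv_fderiv_comp_apply hF L.contDiff.contDiffAt v w, L.fderiv,
    show fderiv ℝ (fderiv ℝ (⇑L)) u₀ = 0 by
      rw [show fderiv ℝ (⇑L) = fun _ => L from funext fun u => L.fderiv]; exact fderiv_const_apply _]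
  simp

end Calculus

/-! ### The coordinate maps on `ℝ⁴` -/

namespace RadialThickening

open PlanarThickening (lift ez)

/-- The projection `π(x₀, x₁, x₂, x₃) = (x₀, x₁)` onto the core plane, `ℝ⁴ → ℝ²`. [folklore] -/
def proj : 𝔼 4 →L[ℝ] 𝔼 2 :=
  LinearMap.toContinuousLinearMap
    { toFun := fun p => WithLp.toLp 2 ![p 0, p 1]
      map_add' := fun p p' => by ext i; fin_cases i <;> simp
      map_smul' := fun a p => by ext i; fin_cases i <;> simp }

/-- `(π p)₀ = p₀`. [folklore] -/
@[simp] theorem proj_apply_zero (p : 𝔼 4) : proj p 0 = p 0 := rfl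

/-- `(π p)₁ = p₁`. [folklore] -/
@[simp] theorem proj_apply_one (p : 𝔼 4) : proj p 1 = p 1 := rfl

/-- The core embedding `ι₄(u₀, u₁) = (u₀, u₁, 0, 0)`, `ℝ² → ℝ⁴`. [folklore] -/
def lift₄ : 𝔼 2 →L[ℝ] 𝔼 4 :=
  LinearMap.toContinuousLinearMap
    { toFun := fun u => WithLp.toLp 2 ![u 0, u 1, 0, 0]
      map_add' := fun u u' => by ext i; fin_cases i <;> simp
      map_smul' := fun a u => by ext i; fin_cases i <;> simp }

/-- `(ι₄ u)₀ = u₀`. [folklore] -/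
@[simp] theorem lift₄_apply_zero (u : 𝔼 2) : lift₄ u 0 = u 0 := rfl

/-- `(ι₄ u)₁ = u₁`. [folklore] -/
@[simp] theorem lift₄_apply_one (u : 𝔼 2) : lift₄ u 1 = u 1 := rfl

/-- `(ι₄ u)₂ = 0`. [folklore] -/
@[simp] theorem lift₄_apply_two (u : 𝔼 2) : lift₄ u 2 = 0 := rfl

/-- `(ι₄ u)₃ = 0`. [folklore] -/
@[simp] theorem lift₄_apply_three (u : 𝔼 2) : lift₄ u 3 = 0 := rfl

/-- `π ∘ ι₄ = id`. [folklore] -/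
@[simp] theorem proj_lift₄ (u : 𝔼 2) : proj (lift₄ u) = u := by
  ext i; fin_cases i <;> rfl

/-- The co-core coordinate functional `dy₀ : p ↦ p₂`. [folklore] -/
abbrev c2 : 𝔼 4 →L[ℝ] ℝ := EuclideanSpace.proj (2 : Fin 4)

/-- The co-core coordinate functional `dy₁ : p ↦ p₃`. [folklore] -/
abbrev c3 : 𝔼 4 →L[ℝ] ℝ := EuclideanSpace.proj (3 : Fin 4)

/-- `dy₀ p = p₂` (definitional). [folklore] -/
@[simp] theorem c2_apply (p : 𝔼 4) : c2 p = p 2 := rfl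

/-- `dy₁ p = p₃` (definitional). [folklore] -/
@[simp] theorem c3_apply (p : 𝔼 4) : c3 p = p 3 := rfl

/-- The co-core basis vector `e₂ = (0, 0, 1, 0)` of `ℝ⁴`. [folklore] -/
def e2 : 𝔼 4 := WithLp.toLp 2 ![0, 0, 1, 0]

/-- The co-core basis vector `e₃ = (0, 0, 0, 1)` of `ℝ⁴`. [folklore] -/
def e3 : 𝔼 4 := WithLp.toLp 2 ![0, 0, 0, 1]

/-- `(e₂)₂ = 1`. [folklore] -/
@[simp] theorem e2_apply_two : e2 2 = 1 := rfl
/-- `(e₂)₃ = 0`. [folklore] -/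
@[simp] theorem e2_apply_three : e2 3 = 0 := rfl
/-- `(e₃)₂ = 0`. [folklore] -/
@[simp] theorem e3_apply_two : e3 2 = 0 := rfl
/-- `(e₃)₃ = 1`. [folklore] -/
@[simp] theorem e3_apply_three : e3 3 = 1 := rfl
/-- `π e₂ = 0`. [folklore] -/
@[simp] theorem proj_e2 : proj e2 = 0 := by ext i; fin_cases i <;> rfl
/-- `π e₃ = 0`. [folklore] -/
@[simp] theorem proj_e3 : proj e3 = 0 := by ext i; fin_cases i <;> rfl

/-- `p = ι₄ (π p)` iff `p₂ = p₃ = 0` (the point lies on the core plane). [folklore] -/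
theorem eq_lift₄_proj_iff (p : 𝔼 4) : p = lift₄ (proj p) ↔ p 2 = 0 ∧ p 3 = 0 := by
  constructor
  · intro h
    exact ⟨by simpa using congrArg (fun v : 𝔼 4 => v 2) h,
      by simpa using congrArg (fun v : 𝔼 4 => v 3) h⟩
  · rintro ⟨h2, h3⟩
    ext i; fin_cases i
    · rfl
    · rfl
    · simpa using h2
    · simpa using h3

/-- Decomposition `p = ι₄ (π p) + p₂ e₂ + p₃ e₃`, read coordinatewise:
`v = ι₄ (π v)` exactly for vectors with `v₂ = v₃ = 0`; in general `π` forgets `v₂, v₃`. [folklore] -/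
theorem lift₄_proj_apply (p : 𝔼 4) (i : Fin 4) :
    lift₄ (proj p) i = if i = 2 ∨ i = 3 then 0 else p i := by
  fin_cases i <;> rfl

/-- **The squared co-core radius** `b(p) = p₂² + p₃² = |y|²`. [cite: MilnorHCobordism1965, Def. 3.1] -/
def bsq (p : 𝔼 4) : ℝ := p 2 ^ 2 + p 3 ^ 2

/-- Unfolding of `bsq`. [folklore] -/
theorem bsq_apply (p : 𝔼 4) : bsq p = p 2 ^ 2 + p 3 ^ 2 := rfl

/-- `b ≥ 0`. [folklore] -/
theorem bsq_nonneg (p : 𝔼 4) : 0 ≤ bsq p := by rw [bsq_apply]; positivity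

/-- `b(p) = 0` iff `p₂ = p₃ = 0`. [folklore] -/
theorem bsq_eq_zero_iff (p : 𝔼 4) : bsq p = 0 ↔ p 2 = 0 ∧ p 3 = 0 := by
  rw [bsq_apply]
  constructor
  · intro h
    have h2 : p 2 ^ 2 = 0 := by nlinarith [sq_nonneg (p 2), sq_nonneg (p 3)]
    have h3 : p 3 ^ 2 = 0 := by nlinarith [sq_nonneg (p 2), sq_nonneg (p 3)]
    exact ⟨pow_eq_zero_iff (n := 2) (by norm_num) |>.1 h2, pow_eq_zero_iff (n := 2) (by norm_num) |>.1 h3⟩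
  · rintro ⟨h2, h3⟩
    simp [h2, h3]

/-- `b (ι₄ u) = 0`. [folklore] -/
@[simp] theorem bsq_lift₄ (u : 𝔼 2) : bsq (lift₄ u) = 0 := by simp [bsq_apply]

/-- **The model map** `toModel (x₀, x₁, x₂, x₃) = (x₀, x₁, x₂² + x₃²) ∈ ℝ³`: core coordinates
and squared co-core radius. [cite: MilnorHCobordism1965, Def. 3.1] -/
def toModel (p : 𝔼 4) : 𝔼 3 := lift (proj p) + bsq p • ez

/-- `(toModel p)₀ = p₀`. [folklore] -/
@[simp] theorem toModel_apply_zero (p : 𝔼 4) : toModel p 0 = p 0 := by simp [toModel]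

/-- `(toModel p)₁ = p₁`. [folklore] -/
@[simp] theorem toModel_apply_one (p : 𝔼 4) : toModel p 1 = p 1 := by simp [toModel]

/-- `(toModel p)₂ = b(p) = p₂² + p₃²`. [folklore] -/
@[simp] theorem toModel_apply_two (p : 𝔼 4) : toModel p 2 = bsq p := by simp [toModel]

/-- On the core plane `toModel (ι₄ u) = ι u`. [folklore] -/
@[simp] theorem toModel_lift₄ (u : 𝔼 2) : toModel (lift₄ u) = lift u := by
  rw [toModel, bsq_lift₄, zero_smul, add_zero, proj_lift₄]

/-- `toModel p = ι (π p)` when `p₂ = p₃ = 0`. [folklore] -/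
theorem toModel_eq_lift_proj {p : 𝔼 4} (h2 : p 2 = 0) (h3 : p 3 = 0) :
    toModel p = lift (proj p) := by
  rw [toModel, (bsq_eq_zero_iff p).2 ⟨h2, h3⟩, zero_smul, add_zero]

/-- **The radial thickening** of `Φ : ℝ³ → ℝ`: `rthicken Φ (x, y) = Φ(x, |y|²)`,
`x, y ∈ ℝ²` — a function on the handle that is rotation-invariant in the co-core variable.
[cite: GayKirby2016, §4, proof of Lemma 14] -/
def rthicken (Φ : 𝔼 3 → ℝ) (p : 𝔼 4) : ℝ := Φ (toModel p)

/-- Unfolding of `rthicken`. [folklore] -/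
theorem rthicken_apply (Φ : 𝔼 3 → ℝ) (p : 𝔼 4) : rthicken Φ p = Φ (toModel p) := rfl

/-- `rthicken Φ = Φ ∘ toModel`. [folklore] -/
theorem rthicken_eq_comp (Φ : 𝔼 3 → ℝ) : rthicken Φ = Φ ∘ toModel := rfl

/-- On the core plane the radial thickening is the core function `g₀ = Φ ∘ ι`:
`rthicken Φ (ι₄ u) = Φ (ι u)`. [folklore] -/
@[simp] theorem rthicken_lift₄ (Φ : 𝔼 3 → ℝ) (u : 𝔼 2) : rthicken Φ (lift₄ u) = Φ (lift u) := by
  rw [rthicken_apply, toModel_lift₄]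

variable {Φ : 𝔼 3 → ℝ}

/-! ### First derivatives -/

/-- `db_p = 2 p₂ dy₀ + 2 p₃ dy₁`. [folklore] -/
theorem hasFDerivAt_bsq (p : 𝔼 4) :
    HasFDerivAt bsq ((2 * p 2) • (c2 : 𝔼 4 →L[ℝ] ℝ) + (2 * p 3) • (c3 : 𝔼 4 →L[ℝ] ℝ)) p := by
  have h2 : HasFDerivAt (fun p : 𝔼 4 => (c2 : 𝔼 4 →L[ℝ] ℝ) p ^ 2) _ p :=
    (c2.hasFDerivAt (x := p)).pow 2
  have h3 : HasFDerivAt (fun p : 𝔼 4 => (c3 : 𝔼 4 →L[ℝ] ℝ) p ^ 2) _ p :=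
    (c3.hasFDerivAt (x := p)).pow 2
  refine (h2.add h3).congr_fderiv ?_
  ext v
  simp

/-- `fderiv bsq`. [folklore] -/
theorem fderiv_bsq (p : 𝔼 4) :
    fderiv ℝ bsq p = (2 * p 2) • (c2 : 𝔼 4 →L[ℝ] ℝ) + (2 * p 3) • (c3 : 𝔼 4 →L[ℝ] ℝ) :=
  (hasFDerivAt_bsq p).fderiv

/-- `db_p v = 2 (p₂ v₂ + p₃ v₃)`. [folklore] -/
theorem fderiv_bsq_apply (p v : 𝔼 4) : fderiv ℝ bsq p v = 2 * p 2 * v 2 + 2 * p 3 * v 3 := by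
  rw [fderiv_bsq]; simp

/-- `bsq` is smooth. [folklore] -/
theorem contDiff_bsq {n : WithTop ℕ∞} : ContDiff ℝ n bsq :=
  ((c2.contDiff).pow 2).add ((c3.contDiff).pow 2)

/-- The constant part `ι ∘ π` of `D(toModel)`, as a continuous linear map `ℝ⁴ → ℝ³`. [folklore] -/
abbrev liftProj : 𝔼 4 →L[ℝ] 𝔼 3 := (lift : 𝔼 2 →L[ℝ] 𝔼 3).comp proj

/-- **First derivative of `toModel`**: `D(toModel)_p = ι ∘ π + db_p ⊗ e₂`. [folklore] -/
theorem hasFDerivAt_toModel (p : 𝔼 4) :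
    HasFDerivAt toModel (liftProj + ((2 * p 2) • (c2 : 𝔼 4 →L[ℝ] ℝ) +
      (2 * p 3) • (c3 : 𝔼 4 →L[ℝ] ℝ)).smulRight ez) p :=
  (liftProj.hasFDerivAt (x := p)).add ((hasFDerivAt_bsq p).smul_const ez)

/-- `fderiv toModel`. [folklore] -/
theorem fderiv_toModel (p : 𝔼 4) :
    fderiv ℝ toModel p = liftProj + (fderiv ℝ bsq p).smulRight ez := by
  rw [(hasFDerivAt_toModel p).fderiv, fderiv_bsq]

/-- `D(toModel)_p v = ι (π v) + db_p(v) e₂`. [folklore] -/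
theorem fderiv_toModel_apply (p v : 𝔼 4) :
    fderiv ℝ toModel p v = lift (proj v) + (2 * p 2 * v 2 + 2 * p 3 * v 3) • ez := by
  rw [fderiv_toModel, add_apply, ContinuousLinearMap.smulRight_apply, fderiv_bsq_apply]
  rfl

/-- On the core plane `D(toModel)_p = ι ∘ π`. [folklore] -/
theorem fderiv_toModel_of_eq_zero {p : 𝔼 4} (h2 : p 2 = 0) (h3 : p 3 = 0) :
    fderiv ℝ toModel p = liftProj := by
  rw [fderiv_toModel, fderiv_bsq, h2, h3]; simp

/-- `toModel` is smooth. [folklore] -/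
theorem contDiff_toModel {n : WithTop ℕ∞} : ContDiff ℝ n toModel :=
  liftProj.contDiff.add (contDiff_bsq.smul contDiff_const)

/-- **First derivative of the radial thickening**: `D(Φ ∘ toModel)_p = DΦ_{toModel p} ∘ D(toModel)_p`.
[folklore] -/
theorem hasFDerivAt_rthicken {Φ' : 𝔼 3 →L[ℝ] ℝ} {p : 𝔼 4} (hΦ : HasFDerivAt Φ Φ' (toModel p)) :
    HasFDerivAt (rthicken Φ) (Φ'.comp (fderiv ℝ toModel p)) p := by
  rw [rthicken_eq_comp]
  exact hΦ.comp p (hasFDerivAt_toModel p).differentiableAt.hasFDerivAt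

/-- `fderiv` of the radial thickening. [folklore] -/
theorem fderiv_rthicken {p : 𝔼 4} (hΦ : DifferentiableAt ℝ Φ (toModel p)) :
    fderiv ℝ (rthicken Φ) p = (fderiv ℝ Φ (toModel p)).comp (fderiv ℝ toModel p) :=
  (hasFDerivAt_rthicken hΦ.hasFDerivAt).fderiv

/-- `D(rthicken Φ)_p v = DΦ(ι (π v)) + 2 (p₂ v₂ + p₃ v₃) ∂Φ/∂b`, all derivatives of `Φ` at
`toModel p`. [folklore] -/
theorem fderiv_rthicken_apply {p : 𝔼 4} (hΦ : DifferentiableAt ℝ Φ (toModel p)) (v : 𝔼 4) :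
    fderiv ℝ (rthicken Φ) p v = fderiv ℝ Φ (toModel p) (lift (proj v)) +
      (2 * p 2 * v 2 + 2 * p 3 * v 3) * fderiv ℝ Φ (toModel p) ez := by
  rw [fderiv_rthicken hΦ, ContinuousLinearMap.comp_apply, fderiv_toModel_apply, map_add,
    map_smul, smul_eq_mul]

/-- The radial thickening of a `C^n` function is `C^n`; pointwise version. [folklore] -/
theorem contDiffAt_rthicken {n : WithTop ℕ∞} {p : 𝔼 4} (hΦ : ContDiffAt ℝ n Φ (toModel p)) :
    ContDiffAt ℝ n (rthicken Φ) p :=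
  hΦ.comp p contDiff_toModel.contDiffAt

/-- The radial thickening of a `C^n` function is `C^n`. [folklore] -/
theorem contDiff_rthicken {n : WithTop ℕ∞} (hΦ : ContDiff ℝ n Φ) : ContDiff ℝ n (rthicken Φ) :=
  hΦ.comp contDiff_toModel

/-- **Critical points of the radial thickening lie on the core plane.**  If `∂Φ/∂b ≠ 0` at
`toModel p` then `D(rthicken Φ)_p = 0` iff `p₂ = p₃ = 0` and `DΦ_{toModel p} ∘ ι = 0`
(evaluate on `e₂`, `e₃` to get `2 p₂ ∂Φ/∂b = 2 p₃ ∂Φ/∂b = 0`, then on `ι₄ u`).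
[cite: GayKirby2016, §4, proof of Lemma 14] -/
theorem fderiv_rthicken_eq_zero_iff {p : 𝔼 4} (hΦ : DifferentiableAt ℝ Φ (toModel p))
    (hb : fderiv ℝ Φ (toModel p) ez ≠ 0) :
    fderiv ℝ (rthicken Φ) p = 0 ↔
      p 2 = 0 ∧ p 3 = 0 ∧ (fderiv ℝ Φ (toModel p)).comp (lift : 𝔼 2 →L[ℝ] 𝔼 3) = 0 := by
  constructor
  · intro h
    have hv : ∀ v, fderiv ℝ (rthicken Φ) p v = 0 := fun v => by rw [h]; rfl
    have h2 : p 2 = 0 := by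
      have := hv e2
      rw [fderiv_rthicken_apply hΦ, proj_e2, map_zero, map_zero, zero_add] at this
      simp only [e2_apply_two, e2_apply_three, mul_one, mul_zero, add_zero] at this
      rcases mul_eq_zero.1 this with h' | h'
      · linarith
      · exact absurd h' hb
    have h3 : p 3 = 0 := by
      have := hv e3
      rw [fderiv_rthicken_apply hΦ, proj_e3, map_zero, map_zero, zero_add] at this
      simp only [e3_apply_two, e3_apply_three, mul_one, mul_zero, zero_add] at this
      rcases mul_eq_zero.1 this with h' | h'
      · linarith
      · exact absurd h' hb
    refine ⟨h2, h3, ContinuousLinearMap.ext fun u => ?_⟩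
    have := hv (lift₄ u)
    rw [fderiv_rthicken_apply hΦ, proj_lift₄, h2, h3] at this
    simpa using this
  · rintro ⟨h2, h3, hcomp⟩
    refine ContinuousLinearMap.ext fun v => ?_
    rw [fderiv_rthicken_apply hΦ, h2, h3]
    have := congrArg (fun L : 𝔼 2 →L[ℝ] ℝ => L (proj v)) hcomp
    simp only [ContinuousLinearMap.comp_apply, zero_apply] at this
    simp [this]

/-- The core function `g₀ = Φ ∘ ι` has derivative `DΦ_{ι u} ∘ ι`. [folklore] -/
theorem fderiv_comp_lift {u : 𝔼 2} (hΦ : DifferentiableAt ℝ Φ (lift u)) :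
    fderiv ℝ (Φ ∘ (lift : 𝔼 2 →L[ℝ] 𝔼 3)) u =
      (fderiv ℝ Φ (lift u)).comp (lift : 𝔼 2 →L[ℝ] 𝔼 3) := by
  rw [fderiv_comp u hΦ (lift : 𝔼 2 →L[ℝ] 𝔼 3).differentiableAt, ContinuousLinearMap.fderiv]

/-- **Critical points of the radial thickening, in terms of the core function**: if
`∂Φ/∂b ≠ 0` at `toModel p`, then `D(rthicken Φ)_p = 0` iff `p` lies on the core plane and
`π p` is a critical point of `g₀ = Φ ∘ ι`. [cite: GayKirby2016, §4, proof of Lemma 14] -/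
theorem fderiv_rthicken_eq_zero_iff' {p : 𝔼 4} (hΦ : DifferentiableAt ℝ Φ (toModel p))
    (hb : fderiv ℝ Φ (toModel p) ez ≠ 0) :
    fderiv ℝ (rthicken Φ) p = 0 ↔
      p 2 = 0 ∧ p 3 = 0 ∧ fderiv ℝ (Φ ∘ (lift : 𝔼 2 →L[ℝ] 𝔼 3)) (proj p) = 0 := by
  rw [fderiv_rthicken_eq_zero_iff hΦ hb]
  constructor
  · rintro ⟨h2, h3, h⟩
    have hp : toModel p = lift (proj p) := toModel_eq_lift_proj h2 h3
    refine ⟨h2, h3, ?_⟩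
    rw [fderiv_comp_lift (by rw [← hp]; exact hΦ), ← hp, h]
  · rintro ⟨h2, h3, h⟩
    have hp : toModel p = lift (proj p) := toModel_eq_lift_proj h2 h3
    refine ⟨h2, h3, ?_⟩
    rw [fderiv_comp_lift (by rw [← hp]; exact hΦ), ← hp] at h
    exact h

/-! ### Second derivatives -/

/-- **Second derivative of `bsq`**: `D²b(v, w) = 2 (v₂ w₂ + v₃ w₃)` (as the derivative of
`p ↦ db_p`). [folklore] -/
theorem hasFDerivAt_fderiv_bsq (p : 𝔼 4) :
    HasFDerivAt (fderiv ℝ bsq)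
      (((2 : ℝ) • (c2 : 𝔼 4 →L[ℝ] ℝ)).smulRight (c2 : 𝔼 4 →L[ℝ] ℝ) +
        ((2 : ℝ) • (c3 : 𝔼 4 →L[ℝ] ℝ)).smulRight (c3 : 𝔼 4 →L[ℝ] ℝ)) p := by
  have hfun : fderiv ℝ bsq = fun p : 𝔼 4 =>
      (2 * p 2) • (c2 : 𝔼 4 →L[ℝ] ℝ) + (2 * p 3) • (c3 : 𝔼 4 →L[ℝ] ℝ) :=
    funext fderiv_bsq
  rw [hfun]
  have hs2 : HasFDerivAt (fun p : 𝔼 4 => 2 * p 2) ((2 : ℝ) • (c2 : 𝔼 4 →L[ℝ] ℝ)) p := by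
    simpa using (c2.hasFDerivAt (x := p)).const_mul (2 : ℝ)
  have hs3 : HasFDerivAt (fun p : 𝔼 4 => 2 * p 3) ((2 : ℝ) • (c3 : 𝔼 4 →L[ℝ] ℝ)) p := by
    simpa using (c3.hasFDerivAt (x := p)).const_mul (2 : ℝ)
  exact (hs2.smul_const (c2 : 𝔼 4 →L[ℝ] ℝ)).add (hs3.smul_const (c3 : 𝔼 4 →L[ℝ] ℝ))

/-- `D²b(v)(w) = 2 v₂ w₂ + 2 v₃ w₃`. [folklore] -/
theorem fderiv_fderiv_bsq_apply (p v w : 𝔼 4) :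
    fderiv ℝ (fderiv ℝ bsq) p v w = 2 * v 2 * w 2 + 2 * v 3 * w 3 := by
  rw [(hasFDerivAt_fderiv_bsq p).fderiv]
  simp [ContinuousLinearMap.smulRight_apply]

/-- **Second derivative of `toModel`** (as the derivative of `p ↦ D(toModel)_p`): only the
radial part varies, `D²(toModel)(v)(w) = D²b(v, w) e₂`. [folklore] -/
theorem hasFDerivAt_fderiv_toModel (p : 𝔼 4) :
    HasFDerivAt (fderiv ℝ toModel)
      (((ContinuousLinearMap.smulRightL ℝ (𝔼 4) (𝔼 3)).flip ez).comp
        (((2 : ℝ) • (c2 : 𝔼 4 →L[ℝ] ℝ)).smulRight (c2 : 𝔼 4 →L[ℝ] ℝ) +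
          ((2 : ℝ) • (c3 : 𝔼 4 →L[ℝ] ℝ)).smulRight (c3 : 𝔼 4 →L[ℝ] ℝ))) p := by
  have hfun : fderiv ℝ toModel = fun p : 𝔼 4 =>
      liftProj + ((ContinuousLinearMap.smulRightL ℝ (𝔼 4) (𝔼 3)).flip ez) (fderiv ℝ bsq p) := by
    funext p
    rw [fderiv_toModel]
    rfl
  rw [hfun]
  exact (((ContinuousLinearMap.smulRightL ℝ (𝔼 4) (𝔼 3)).flip ez).hasFDerivAt.comp p
    (hasFDerivAt_fderiv_bsq p)).const_add liftProj

/-- `D²(toModel)(v)(w) = (2 v₂ w₂ + 2 v₃ w₃) e₂`. [folklore] -/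
theorem fderiv_fderiv_toModel_apply (p v w : 𝔼 4) :
    fderiv ℝ (fderiv ℝ toModel) p v w = (2 * v 2 * w 2 + 2 * v 3 * w 3) • ez := by
  rw [(hasFDerivAt_fderiv_toModel p).fderiv]
  simp [ContinuousLinearMap.smulRightL, ContinuousLinearMap.smulRight_apply]
  rw [smul_smul, smul_smul, ← add_smul]

/-- **The Hessian of the radial thickening on the core plane**: for `Φ` of class `C²` at
`toModel p` and `p₂ = p₃ = 0`,
`D²(rthicken Φ)_p(v, w) = D²g₀_{π p}(π v, π w) + 2 (∂Φ/∂b) (v₂ w₂ + v₃ w₃)`,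
where `g₀ = Φ ∘ ι` is the core function and `∂Φ/∂b = DΦ_{toModel p}(e₂)` (second-order chain
rule: on the core plane `D(toModel) = ι ∘ π` and `D²(toModel)(v, w) = 2(v₂w₂ + v₃w₃) e₂`).
[cite: GayKirby2016, §4, proof of Lemma 14] [cite: Milnor1963, §2] -/
theorem fderiv_fderiv_rthicken_apply {p : 𝔼 4} (hΦ : ContDiffAt ℝ 2 Φ (toModel p))
    (h2 : p 2 = 0) (h3 : p 3 = 0) (v w : 𝔼 4) :
    fderiv ℝ (fderiv ℝ (rthicken Φ)) p v w =
      fderiv ℝ (fderiv ℝ (Φ ∘ (lift : 𝔼 2 →L[ℝ] 𝔼 3))) (proj p) (proj v) (proj w) +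
        2 * fderiv ℝ Φ (toModel p) ez * (v 2 * w 2 + v 3 * w 3) := by
  have hp : toModel p = lift (proj p) := toModel_eq_lift_proj h2 h3
  rw [rthicken_eq_comp, fderiv_fderiv_comp_apply hΦ contDiff_toModel.contDiffAt,
    fderiv_toModel_of_eq_zero h2 h3, fderiv_fderiv_toModel_apply, map_smul, smul_eq_mul,
    fderiv_fderiv_comp_clm_apply (lift : 𝔼 2 →L[ℝ] 𝔼 3) (by rw [← hp]; exact hΦ), ← hp]
  simp only [ContinuousLinearMap.comp_apply]
  ring

/-! ### Morse data on the model spaces `𝓡 4`, `𝓡 2` -/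

/-- **Critical points of the radial thickening** (`Morse.lean` vocabulary on the model space):
if `∂Φ/∂b ≠ 0` at `toModel p`, then `p` is a critical point of `rthicken Φ` iff `p₂ = p₃ = 0`
and `π p` is a critical point of the core function `g₀ = Φ ∘ ι`.
[cite: GayKirby2016, §4, proof of Lemma 14] -/
theorem isMCriticalPt_rthicken_iff {p : 𝔼 4} (hΦ : DifferentiableAt ℝ Φ (toModel p))
    (hb : fderiv ℝ Φ (toModel p) ez ≠ 0) :
    IsMCriticalPt (𝓡 4) (rthicken Φ) p ↔
      p 2 = 0 ∧ p 3 = 0 ∧ IsMCriticalPt (𝓡 2) (Φ ∘ (lift : 𝔼 2 →L[ℝ] 𝔼 3)) (proj p) := by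
  rw [MorseBirth.isMCriticalPt_iff_fderiv, MorseBirth.isMCriticalPt_iff_fderiv,
    fderiv_rthicken_eq_zero_iff' hΦ hb]

/-- A critical point of the radial thickening (with `∂Φ/∂b ≠ 0`) lies on the core plane:
`p = ι₄ (π p)`. [cite: GayKirby2016, §4, proof of Lemma 14] -/
theorem eq_lift₄_proj_of_isMCriticalPt {p : 𝔼 4} (hΦ : DifferentiableAt ℝ Φ (toModel p))
    (hb : fderiv ℝ Φ (toModel p) ez ≠ 0) (hp : IsMCriticalPt (𝓡 4) (rthicken Φ) p) :
    p = lift₄ (proj p) := by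
  rw [isMCriticalPt_rthicken_iff hΦ hb] at hp
  exact (eq_lift₄_proj_iff p).2 ⟨hp.1, hp.2.1⟩

/-- **The Hessian of the radial thickening on the core plane**
(`Literature.Topology.FourManifolds.mhessian` on the model spaces is the second Fréchet
derivative, `MorseBirth.mhessian_model_apply`):
`Hess (rthicken Φ)_p (v, w) = Hess (g₀)_{π p} (π v, π w) + 2 (∂Φ/∂b) (v₂ w₂ + v₃ w₃)`.
[cite: Milnor1963, §2] -/
theorem mhessian_rthicken_apply {p : 𝔼 4} (hΦ : ContDiffAt ℝ 2 Φ (toModel p))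
    (h2 : p 2 = 0) (h3 : p 3 = 0) (v w : 𝔼 4) :
    mhessian (𝓡 4) (rthicken Φ) p v w =
      mhessian (𝓡 2) (Φ ∘ (lift : 𝔼 2 →L[ℝ] 𝔼 3)) (proj p) (proj v) (proj w) +
        2 * fderiv ℝ Φ (toModel p) ez * (v 2 * w 2 + v 3 * w 3) := by
  rw [MorseBirth.mhessian_model_apply, MorseBirth.mhessian_model_apply,
    fderiv_fderiv_rthicken_apply hΦ h2 h3]

/-- **Nondegeneracy on the core plane**: for `∂Φ/∂b ≠ 0`, the Hessian of `rthicken Φ` at a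
point `p` of the core plane is nondegenerate iff the Hessian of the core function `g₀` at
`π p` is. [cite: Milnor1963, §2] -/
theorem nondegenerate_mhessian_rthicken_iff {p : 𝔼 4} (hΦ : ContDiffAt ℝ 2 Φ (toModel p))
    (h2 : p 2 = 0) (h3 : p 3 = 0) (hb : fderiv ℝ Φ (toModel p) ez ≠ 0) :
    (mhessian (𝓡 4) (rthicken Φ) p).Nondegenerate ↔
      (mhessian (𝓡 2) (Φ ∘ (lift : 𝔼 2 →L[ℝ] 𝔼 3)) (proj p)).Nondegenerate := by
  set B := mhessian (𝓡 2) (Φ ∘ (lift : 𝔼 2 →L[ℝ] 𝔼 3)) (proj p) with hB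
  set β : ℝ := fderiv ℝ Φ (toModel p) ez with hβ
  have key : ∀ v w : 𝔼 4, mhessian (𝓡 4) (rthicken Φ) p v w =
      B (proj v) (proj w) + 2 * β * (v 2 * w 2 + v 3 * w 3) := mhessian_rthicken_apply hΦ h2 h3
  -- test vectors
  have hl : ∀ u : 𝔼 2, ∀ w : 𝔼 4, mhessian (𝓡 4) (rthicken Φ) p (lift₄ u) w = B u (proj w) ∧
      mhessian (𝓡 4) (rthicken Φ) p w (lift₄ u) = B (proj w) u := fun u w => by
    constructor <;> · rw [key]; simp
  have he2 : ∀ w : 𝔼 4, mhessian (𝓡 4) (rthicken Φ) p e2 w = 2 * β * w 2 ∧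
      mhessian (𝓡 4) (rthicken Φ) p w e2 = 2 * β * w 2 := fun w => by
    constructor <;>
    · rw [key]
      simp
  have he3 : ∀ w : 𝔼 4, mhessian (𝓡 4) (rthicken Φ) p e3 w = 2 * β * w 3 ∧
      mhessian (𝓡 4) (rthicken Φ) p w e3 = 2 * β * w 3 := fun w => by
    constructor <;>
    · rw [key]
      simp
  have hβ2 : (2 : ℝ) * β ≠ 0 := mul_ne_zero two_ne_zero hb
  constructor
  · intro hN
    refine ⟨fun u hu => ?_, fun u hu => ?_⟩
    · -- left kernel of `B` lifts to the left kernel of the big form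
      have : lift₄ u = 0 := hN.1 (lift₄ u) fun w => by rw [(hl u w).1]; exact hu (proj w)
      simpa using congrArg proj this
    · have : lift₄ u = 0 := hN.2 (lift₄ u) fun w => by rw [(hl u w).2]; exact hu (proj w)
      simpa using congrArg proj this
  · intro hN
    have aux : ∀ v : 𝔼 4, (∀ w, mhessian (𝓡 4) (rthicken Φ) p v w = 0) →
        (∀ w, mhessian (𝓡 4) (rthicken Φ) p w v = 0) → v = 0 := by
      intro v hvl hvr
      have hv2 : v 2 = 0 := by
        have := hvr e2
        rw [(he2 v).1] at this
        rcases mul_eq_zero.1 this with h | h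
        · exact absurd h hβ2
        · exact h
      have hv3 : v 3 = 0 := by
        have := hvr e3
        rw [(he3 v).1] at this
        rcases mul_eq_zero.1 this with h | h
        · exact absurd h hβ2
        · exact h
      have hπl : proj v = 0 := hN.1 (proj v) fun u => by
        have := hvl (lift₄ u)
        rw [key, proj_lift₄] at this
        simpa [hv2, hv3] using this
      rw [(eq_lift₄_proj_iff v).2 ⟨hv2, hv3⟩, hπl, map_zero]
    refine ⟨fun v hv => aux v hv fun w => ?_, fun v hv => aux v (fun w => ?_) hv⟩
    · -- from the left kernel get the right kernel values needed by `aux` via the formula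
      rw [key]
      have h1 := hv w
      rw [key] at h1
      have hv2 : v 2 = 0 := by
        have := hv e2
        rw [(he2 v).2] at this
        rcases mul_eq_zero.1 this with h | h
        · exact absurd h hβ2
        · exact h
      have hv3 : v 3 = 0 := by
        have := hv e3
        rw [(he3 v).2] at this
        rcases mul_eq_zero.1 this with h | h
        · exact absurd h hβ2
        · exact h
      have hπ : proj v = 0 := hN.1 (proj v) fun u => by
        have := hv (lift₄ u)
        rw [key, proj_lift₄] at this
        simpa [hv2, hv3] using this
      simp [hπ, hv2, hv3]
    · rw [key]
      have hv2 : v 2 = 0 := by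
        have := hv e2
        rw [(he2 v).1] at this
        rcases mul_eq_zero.1 this with h | h
        · exact absurd h hβ2
        · exact h
      have hv3 : v 3 = 0 := by
        have := hv e3
        rw [(he3 v).1] at this
        rcases mul_eq_zero.1 this with h | h
        · exact absurd h hβ2
        · exact h
      have hπ : proj v = 0 := hN.2 (proj v) fun u => by
        have := hv (lift₄ u)
        rw [key, proj_lift₄] at this
        simpa [hv2, hv3] using this
      simp [hπ, hv2, hv3]

/-- **The Morse index of the radial thickening is that of the core function** when
`∂Φ/∂b > 0`: on the core plane `Hess (rthicken Φ)_p = Hess (g₀)_{π p} ∘ (π × π) + 2 (∂Φ/∂b)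
(dy₀² + dy₁²)`, a positive square split off along `π` (`Literature.Topology.FourManifolds.sigNeg_eq_of_proj`,
Sylvester's law; Milnor 1963, §2).  This is why the `2`-handle contributes no critical point of
index `≥ 2` to the sector `X₂` once the core function has only minima and saddles (Gay–Kirby
2016, proof of Lemma 14: the `2`-handles cancel `1`-handles of `[0, ε] × H₁₂`).
[cite: Milnor1963, §2] [cite: GayKirby2016, §4, proof of Lemma 14] -/
theorem morseIndex_rthicken {p : 𝔼 4} (hΦ : ContDiffAt ℝ 2 Φ (toModel p)) (h2 : p 2 = 0)
    (h3 : p 3 = 0) (hb : 0 < fderiv ℝ Φ (toModel p) ez) :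
    morseIndex (𝓡 4) (rthicken Φ) p =
      morseIndex (𝓡 2) (Φ ∘ (lift : 𝔼 2 →L[ℝ] 𝔼 3)) (proj p) := by
  unfold morseIndex
  refine sigNeg_eq_of_proj _ _ (proj : 𝔼 4 →L[ℝ] 𝔼 2).toLinearMap
    (lift₄ : 𝔼 2 →L[ℝ] 𝔼 4).toLinearMap (fun v => ?_) (fun v hv => ?_) (fun w => ?_) (fun w => ?_)
  · simp only [LinearMap.BilinMap.toQuadraticMap_apply, ContinuousLinearMap.coe_coe,
      mhessian_rthicken_apply hΦ h2 h3]
    nlinarith [sq_nonneg (v 2), sq_nonneg (v 3)]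
  · simp only [ContinuousLinearMap.coe_coe] at hv
    simp only [LinearMap.BilinMap.toQuadraticMap_apply, mhessian_rthicken_apply hΦ h2 h3, hv,
      map_zero, zero_add]
    nlinarith [sq_nonneg (v 2), sq_nonneg (v 3)]
  · simp [LinearMap.BilinMap.toQuadraticMap_apply, mhessian_rthicken_apply hΦ h2 h3]
  · simp

/-- **Critical points of index `i` of the radial thickening are the lifts of those of the
core function** (pointwise form, for `∂Φ/∂b > 0` at `toModel p` and `Φ` of class `C²`
there): `p ∈ Crit_i(rthicken Φ)` iff `p₂ = p₃ = 0` and `π p ∈ Crit_i(g₀)`.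
[cite: GayKirby2016, §4, proof of Lemma 14] [cite: Milnor1963, §2] -/
theorem mem_criticalSetOfIndex_rthicken_iff {p : 𝔼 4} (hΦ : ContDiffAt ℝ 2 Φ (toModel p))
    (hb : 0 < fderiv ℝ Φ (toModel p) ez) (i : ℕ) :
    p ∈ criticalSetOfIndex (𝓡 4) (rthicken Φ) i ↔
      p 2 = 0 ∧ p 3 = 0 ∧ proj p ∈ criticalSetOfIndex (𝓡 2) (Φ ∘ (lift : 𝔼 2 →L[ℝ] 𝔼 3)) i := by
  have hd : DifferentiableAt ℝ Φ (toModel p) := hΦ.differentiableAt (by norm_num)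
  simp only [mem_criticalSetOfIndex, isMCriticalPt_rthicken_iff hd hb.ne']
  constructor
  · rintro ⟨⟨h2, h3, hc⟩, hi⟩
    exact ⟨h2, h3, hc, by rwa [morseIndex_rthicken hΦ h2 h3 hb] at hi⟩
  · rintro ⟨h2, h3, hc, hi⟩
    exact ⟨⟨h2, h3, hc⟩, by rwa [morseIndex_rthicken hΦ h2 h3 hb]⟩

/-- **Nondegenerate critical points transfer** (for `∂Φ/∂b ≠ 0`): at a critical point `p`
of `rthicken Φ`, the Hessian is nondegenerate iff the Hessian of the core function at `π p`
is. [cite: Milnor1963, §2] -/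
theorem nondegenerate_mhessian_rthicken_iff_of_isMCriticalPt {p : 𝔼 4}
    (hΦ : ContDiffAt ℝ 2 Φ (toModel p)) (hb : fderiv ℝ Φ (toModel p) ez ≠ 0)
    (hp : IsMCriticalPt (𝓡 4) (rthicken Φ) p) :
    (mhessian (𝓡 4) (rthicken Φ) p).Nondegenerate ↔
      (mhessian (𝓡 2) (Φ ∘ (lift : 𝔼 2 →L[ℝ] 𝔼 3)) (proj p)).Nondegenerate := by
  have hd : DifferentiableAt ℝ Φ (toModel p) := hΦ.differentiableAt (by norm_num)
  rw [isMCriticalPt_rthicken_iff hd hb] at hp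
  exact nondegenerate_mhessian_rthicken_iff hΦ hp.1 hp.2.1 hb

end RadialThickening

end Literature.Topology.FourManifolds

end
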